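import Mathlib.Analysis.Calculus.Deriv.Shift
import Literature.Analysis.FluidPDE.PassiveScalarClassicalEnergy
import Literature.Analysis.FluidPDE.PassiveScalarWellPosednessProofs
import HarnessLib

/-!
# Time translation, restriction and linearity for classical (forced) passive scalars —
support for line `budgeted-mixer-template` of crux `TwoAndHalfD.ScalarAnomalySteadySourceFormal`
(stmt-AnomalousDissipation-0448), drefute seat (the line card's unregistered support U3).

The stubs `stub_coldStartVariance` / `stub_inputPowerFloor` (and every `_false_without_` lemma on
`stub_sectorMixerRealizable`) release blobs and cold starts at ARBITRARY start times `s ≥ 0`,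
while the tree's well-posedness `Torus.exists_unique_isClassicalScalarTransportForcedOn` lives on
`[0, T]`. This file supplies the plumbing, kernel-checked:

* `forced_restrict` / `forced_restrict_Icc` — restriction of the time set (forced class);
* `forced_sub_forced` (forced − forced, any time set of unique
  differentiability) and `forced_sub_unforced` (forced − unforced is forced: the cold start
  `ρ = θ - φ` of the restart argument);
* `isSmoothSpaceTimeOn_comp_add_right`, `timeDerivWithin_comp_add_right`,
  `forced_comp_add_right` / `unforced_comp_add_right` — time translation `t ↦ t + a`;
* `exists_isClassicalScalarTransportForcedOn_Icc`, `forced_eq_on_Icc`, `exists_isClassicalScalarTransportOn_Icc`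
  — existence and uniqueness of classical forced solutions on ANY window `[a, b]`, `a < b`;
* `exists_isClassicalScalarTransportForcedOn_Ici` — GLOBAL classical forced solutions on `[a, ∞)`
  (gluing; the existence half of `stub_coldStartVariance`'s conclusion).

[folklore: Krylov 1996 Thm 9.2.3 (translation invariance in time); DEIJ2022 (1.1)]
-/

open MeasureTheory Set Filter
open _root_.Topology
open scoped InnerProductSpace ContDiff Pointwise

noncomputable section

namespace Summit.AnomalousDissipation.AnomalousDissipation.Theorems.ScalarAnomalySteadySourceFormal.Negative

open Literature.Analysis Literature.Analysis.FunctionSpaces Literature.Analysis.FunctionSpaces.Torus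
open Literature.Analysis.FluidPDE Literature.Analysis.FluidPDE.Torus

set_option linter.dupNamespace false

variable {d : Type*} [Fintype d] [DecidableEq d]

section RestrictSub

variable {S S' : Set ℝ} {κ : ℝ} {u : ℝ → UnitAddTorus d → EuclideanSpace ℝ d}
  {src θ θ₁ θ₂ φ : ℝ → UnitAddTorus d → ℝ}

/-- **Restriction of the time set (forced class).** A classical forced solution on `S` is one on
any `S' ⊆ S` of unique differentiability (the one-sided time derivatives within `S` and `S'`
agree on `S'`). [folklore] -/
theorem forced_restrict (h : IsClassicalScalarTransportForcedOn S κ u src θ)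
    (hS' : S' ⊆ S) (hU : UniqueDiffOn ℝ S') : IsClassicalScalarTransportForcedOn S' κ u src θ where
  smooth_velocity := h.smooth_velocity.mono hS'
  smooth_source := h.smooth_source.mono hS'
  smooth_scalar := h.smooth_scalar.mono hS'
  transport t ht x := by
    have hd : timeDerivWithin S' θ t x = timeDerivWithin S θ t x :=
      ((h.smooth_scalar.hasDerivWithinAt_slice (hS' ht) x).mono hS').derivWithin (hU t ht)
    rw [hd]
    exact h.transport t (hS' ht) x
  divFree t ht := h.divFree t (hS' ht)

/-- Restriction of a classical forced solution to a closed window `[a, b] ⊆ S`, `a < b`. [folklore] -/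
theorem forced_restrict_Icc (h : IsClassicalScalarTransportForcedOn S κ u src θ)
    {a b : ℝ} (hab : a < b) (hS : Icc a b ⊆ S) :
    IsClassicalScalarTransportForcedOn (Icc a b) κ u src θ :=
  forced_restrict h hS (uniqueDiffOn_Icc hab)

/-- **Linearity (forced − forced).** On any time set of unique differentiability the difference
of two classical forced solutions with the same source solves the homogeneous equation
(the tree's `IsClassicalScalarTransportForcedOn.sub` is the case `S = [0, T]`). [folklore] -/
theorem forced_sub_forced (hU : UniqueDiffOn ℝ S)
    (h₁ : IsClassicalScalarTransportForcedOn S κ u src θ₁)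
    (h₂ : IsClassicalScalarTransportForcedOn S κ u src θ₂) :
    IsClassicalScalarTransportOn S κ u (fun t x => θ₁ t x - θ₂ t x) := by
  refine ⟨h₁.smooth_velocity, h₁.smooth_scalar.sub h₂.smooth_scalar, fun t ht x => ?_, h₁.divFree⟩
  have h1t : IsSmooth (θ₁ t) := h₁.smooth_scalar.isSmooth_slice ht
  have h2t : IsSmooth (θ₂ t) := h₂.smooth_scalar.isSmooth_slice ht
  have hdt : timeDerivWithin S (fun t x => θ₁ t x - θ₂ t x) t x =
      timeDerivWithin S θ₁ t x - timeDerivWithin S θ₂ t x :=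
    ((h₁.smooth_scalar.hasDerivWithinAt_slice ht x).sub
      (h₂.smooth_scalar.hasDerivWithinAt_slice ht x)).derivWithin (hU t ht)
  have h12 : IsSmooth (fun y => θ₁ t y - θ₂ t y) := h1t.sub h2t
  have hgrad : ⟪u t x, gradient (fun y => θ₁ t y - θ₂ t y) x⟫_ℝ =
      ⟪u t x, gradient (θ₁ t) x⟫_ℝ - ⟪u t x, gradient (θ₂ t) x⟫_ℝ := by
    rw [FunctionSpaces.Torus.inner_gradient_eq_sum_mul_partialDeriv (h12.isContDiff (by simp)),
      FunctionSpaces.Torus.inner_gradient_eq_sum_mul_partialDeriv (h1t.isContDiff (by simp)),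
      FunctionSpaces.Torus.inner_gradient_eq_sum_mul_partialDeriv (h2t.isContDiff (by simp)),
      ← Finset.sum_sub_distrib]
    refine Finset.sum_congr rfl fun j _ => ?_
    change u t x j * partialDeriv j (fun y => θ₁ t y - θ₂ t y) x = _
    rw [partialDeriv_sub' h1t h2t, mul_sub]
  have hlap : laplacian (fun y => θ₁ t y - θ₂ t y) x = laplacian (θ₁ t) x - laplacian (θ₂ t) x :=
    laplacian_sub' h1t h2t x
  have e1 := h₁.transport t ht x
  have e2 := h₂.transport t ht x
  change timeDerivWithin S (fun t x => θ₁ t x - θ₂ t x) t x +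
    ⟪u t x, gradient (fun y => θ₁ t y - θ₂ t y) x⟫_ℝ = κ * laplacian (fun y => θ₁ t y - θ₂ t y) x
  rw [hdt, hgrad, hlap]
  linear_combination e1 - e2

/-- **Linearity (forced − unforced).** A classical forced solution minus a classical solution of
the homogeneous equation (same drift, same time set of unique differentiability) is a classical
forced solution with the same source — the cold start `ρ = θ - φ` of the restart argument in
`stub_coldStartVariance` / `stub_inputPowerFloor`. [folklore] -/
theorem forced_sub_unforced (hU : UniqueDiffOn ℝ S)
    (h₁ : IsClassicalScalarTransportForcedOn S κ u src θ)
    (h₂ : IsClassicalScalarTransportOn S κ u φ) :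
    IsClassicalScalarTransportForcedOn S κ u src (fun t x => θ t x - φ t x) := by
  refine ⟨h₁.smooth_velocity, h₁.smooth_source, h₁.smooth_scalar.sub h₂.smooth_scalar,
    fun t ht x => ?_, h₁.divFree⟩
  have h1t : IsSmooth (θ t) := h₁.smooth_scalar.isSmooth_slice ht
  have h2t : IsSmooth (φ t) := h₂.smooth_scalar.isSmooth_slice ht
  have hdt : timeDerivWithin S (fun t x => θ t x - φ t x) t x =
      timeDerivWithin S θ t x - timeDerivWithin S φ t x :=
    ((h₁.smooth_scalar.hasDerivWithinAt_slice ht x).sub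
      (h₂.smooth_scalar.hasDerivWithinAt_slice ht x)).derivWithin (hU t ht)
  have h12 : IsSmooth (fun y => θ t y - φ t y) := h1t.sub h2t
  have hgrad : ⟪u t x, gradient (fun y => θ t y - φ t y) x⟫_ℝ =
      ⟪u t x, gradient (θ t) x⟫_ℝ - ⟪u t x, gradient (φ t) x⟫_ℝ := by
    rw [FunctionSpaces.Torus.inner_gradient_eq_sum_mul_partialDeriv (h12.isContDiff (by simp)),
      FunctionSpaces.Torus.inner_gradient_eq_sum_mul_partialDeriv (h1t.isContDiff (by simp)),
      FunctionSpaces.Torus.inner_gradient_eq_sum_mul_partialDeriv (h2t.isContDiff (by simp)),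
      ← Finset.sum_sub_distrib]
    refine Finset.sum_congr rfl fun j _ => ?_
    change u t x j * partialDeriv j (fun y => θ t y - φ t y) x = _
    rw [partialDeriv_sub' h1t h2t, mul_sub]
  have hlap : laplacian (fun y => θ t y - φ t y) x = laplacian (θ t) x - laplacian (φ t) x :=
    laplacian_sub' h1t h2t x
  have e1 := h₁.transport t ht x
  have e2 := h₂.transport t ht x
  change timeDerivWithin S (fun t x => θ t x - φ t x) t x +
    ⟪u t x, gradient (fun y => θ t y - φ t y) x⟫_ℝ =
      κ * laplacian (fun y => θ t y - φ t y) x + src t x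
  rw [hdt, hgrad, hlap]
  linear_combination e1 - e2

end RestrictSub

section Shift

variable {F : Type*} [NormedAddCommGroup F] [NormedSpace ℝ F]

omit [DecidableEq d] in
/-- Time translation of a jointly smooth space–time field: `(t, x) ↦ φ (t + a, x)` is jointly
smooth on the translated time set `(· + a) ⁻¹' S`. [folklore] -/
theorem isSmoothSpaceTimeOn_comp_add_right {S : Set ℝ} {φ : ℝ → UnitAddTorus d → F}
    (hφ : IsSmoothSpaceTimeOn S φ) (a : ℝ) :
    IsSmoothSpaceTimeOn ((· + a) ⁻¹' S) (fun t x => φ (t + a) x) := by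
  have hl : stLift (fun t x => φ (t + a) x) = stLift φ ∘ fun z : ℝ × EuclideanSpace ℝ d => (z.1 + a, z.2) := by
    funext z; rfl
  unfold IsSmoothSpaceTimeOn
  rw [hl]
  refine hφ.comp ((contDiff_fst.add contDiff_const).prodMk contDiff_snd).contDiffOn ?_
  intro z hz
  exact mk_mem_prod hz.1 (mem_univ _)

/-- The translated set identity `a +ᵥ ((· + a) ⁻¹' S) = S` on `ℝ`. [folklore] -/
theorem vadd_preimage_add_const (a : ℝ) (S : Set ℝ) : a +ᵥ ((· + a) ⁻¹' S) = S := by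
  ext y
  rw [Set.mem_vadd_set]
  constructor
  · rintro ⟨z, hz, rfl⟩
    simpa [vadd_eq_add, add_comm] using hz
  · intro hy
    refine ⟨y - a, ?_, ?_⟩
    · simpa using hy
    · simp [vadd_eq_add]

omit [Fintype d] [DecidableEq d] in
/-- Time translation commutes with the one-sided time derivative:
`∂ₜ[(·+a)⁻¹' S] (φ(· + a)) (t) = ∂ₜ[S] φ (t + a)`. [folklore] -/
theorem timeDerivWithin_comp_add_right {S : Set ℝ} (φ : ℝ → UnitAddTorus d → F) (a t : ℝ)
    (x : UnitAddTorus d) :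
    timeDerivWithin ((· + a) ⁻¹' S) (fun t x => φ (t + a) x) t x = timeDerivWithin S φ (t + a) x := by
  unfold timeDerivWithin
  rw [derivWithin_comp_add_const (fun τ => φ τ x) a ((· + a) ⁻¹' S) t, vadd_preimage_add_const]

variable {S : Set ℝ} {κ : ℝ} {u : ℝ → UnitAddTorus d → EuclideanSpace ℝ d}
  {src θ : ℝ → UnitAddTorus d → ℝ}

/-- **Time translation of classical forced solutions.** If `θ` solves
`∂ₜθ + u·∇θ = κΔθ + src` classically on `S`, then `θ(· + a)` solves the equation with drift
`u(· + a)` and source `src(· + a)` on `(· + a) ⁻¹' S`. [folklore] -/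
theorem forced_comp_add_right
    (h : IsClassicalScalarTransportForcedOn S κ u src θ) (a : ℝ) :
    IsClassicalScalarTransportForcedOn ((· + a) ⁻¹' S) κ (fun t => u (t + a)) (fun t => src (t + a))
      (fun t => θ (t + a)) where
  smooth_velocity := isSmoothSpaceTimeOn_comp_add_right h.smooth_velocity a
  smooth_source := isSmoothSpaceTimeOn_comp_add_right h.smooth_source a
  smooth_scalar := isSmoothSpaceTimeOn_comp_add_right h.smooth_scalar a
  transport t ht x := by
    have hd := timeDerivWithin_comp_add_right (S := S) θ a t x
    change timeDerivWithin ((· + a) ⁻¹' S) (fun t x => θ (t + a) x) t x + _ = _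
    rw [hd]
    exact h.transport (t + a) ht x
  divFree t ht := h.divFree (t + a) ht

/-- Time translation of classical solutions of the homogeneous equation. [folklore] -/
theorem unforced_comp_add_right {φ : ℝ → UnitAddTorus d → ℝ}
    (h : IsClassicalScalarTransportOn S κ u φ) (a : ℝ) :
    IsClassicalScalarTransportOn ((· + a) ⁻¹' S) κ (fun t => u (t + a)) (fun t => φ (t + a)) where
  smooth_velocity := isSmoothSpaceTimeOn_comp_add_right h.smooth_velocity a
  smooth_scalar := isSmoothSpaceTimeOn_comp_add_right h.smooth_scalar a
  transport t ht x := by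
    have hd := timeDerivWithin_comp_add_right (S := S) φ a t x
    change timeDerivWithin ((· + a) ⁻¹' S) (fun t x => φ (t + a) x) t x + _ = _
    rw [hd]
    exact h.transport (t + a) ht x
  divFree t ht := h.divFree (t + a) ht

end Shift

section Window

variable {κ a b : ℝ} {u : ℝ → UnitAddTorus d → EuclideanSpace ℝ d}
  {src : ℝ → UnitAddTorus d → ℝ} {θ₀ : UnitAddTorus d → ℝ}

/-- `(· + a) ⁻¹' [a, b] = [0, b - a]`. [folklore] -/
theorem preimage_add_const_Icc_self (a b : ℝ) : (· + a) ⁻¹' Icc a b = Icc 0 (b - a) := by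
  rw [Set.preimage_add_const_Icc, sub_self]

/-- `(· + (-a)) ⁻¹' [0, b - a] = [a, b]`. [folklore] -/
theorem preimage_add_neg_Icc (a b : ℝ) : (· + (-a)) ⁻¹' Icc 0 (b - a) = Icc a b := by
  rw [Set.preimage_add_const_Icc]
  congr 1 <;> ring

/-- **Existence of classical forced solutions on any window `[a, b]`, `a < b`** (`κ > 0`, smooth
divergence-free drift, smooth source, smooth datum at time `a`): translate to `[0, b - a]`, apply
the tree's `Torus.exists_isClassicalScalarTransportForcedOn`, translate back. [cite: Krylov1996, Thm. 9.2.3] -/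
theorem exists_isClassicalScalarTransportForcedOn_Icc (hκ : 0 < κ) (hab : a < b)
    (hu : IsSmoothSpaceTimeOn (Icc a b) u) (hdiv : ∀ t ∈ Icc a b, IsDivFree (u t))
    (hs : IsSmoothSpaceTimeOn (Icc a b) src) (hθ₀ : IsSmooth θ₀) :
    ∃ θ : ℝ → UnitAddTorus d → ℝ,
      IsClassicalScalarTransportForcedOn (Icc a b) κ u src θ ∧ θ a = θ₀ := by
  have hT : 0 < b - a := sub_pos.2 hab
  -- translated data on `[0, b - a]`
  have hu' : IsSmoothSpaceTimeOn (Icc 0 (b - a)) (fun t x => u (t + a) x) := by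
    have := isSmoothSpaceTimeOn_comp_add_right hu a
    rwa [preimage_add_const_Icc_self] at this
  have hs' : IsSmoothSpaceTimeOn (Icc 0 (b - a)) (fun t x => src (t + a) x) := by
    have := isSmoothSpaceTimeOn_comp_add_right hs a
    rwa [preimage_add_const_Icc_self] at this
  have hdiv' : ∀ t ∈ Icc 0 (b - a), IsDivFree ((fun t x => u (t + a) x) t) := by
    intro t ht
    exact hdiv (t + a) ⟨by linarith [ht.1], by linarith [ht.2]⟩
  obtain ⟨θ', hθ', h0⟩ := exists_isClassicalScalarTransportForcedOn hκ hT hu' hdiv' hs' hθ₀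
  refine ⟨fun t => θ' (t + (-a)), ?_, ?_⟩
  · have hback := forced_comp_add_right hθ' (-a)
    rw [preimage_add_neg_Icc] at hback
    have hu'' : (fun t => (fun t x => u (t + a) x) (t + -a)) = u := by
      funext t x; simp
    have hs'' : (fun t => (fun t x => src (t + a) x) (t + -a)) = src := by
      funext t x; simp
    rw [hu'', hs''] at hback
    exact hback
  · change θ' (a + -a) = θ₀
    rw [add_neg_cancel]
    exact h0

/-- **Uniqueness of classical forced solutions on any window `[a, b]`, `a < b`** (`κ > 0`):
two classical forced solutions with the same datum at time `a` agree on `[a, b]` (translate and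
apply the tree's `IsClassicalScalarTransportForcedOn.eq_on_Icc`). [cite: Krylov1996, Thm. 9.2.3] -/
theorem forced_eq_on_Icc (hκ : 0 < κ) (hab : a < b)
    {θ₁ θ₂ : ℝ → UnitAddTorus d → ℝ}
    (h₁ : IsClassicalScalarTransportForcedOn (Icc a b) κ u src θ₁)
    (h₂ : IsClassicalScalarTransportForcedOn (Icc a b) κ u src θ₂) (h0 : θ₁ a = θ₂ a) :
    ∀ t ∈ Icc a b, θ₁ t = θ₂ t := by
  have hT : 0 < b - a := sub_pos.2 hab
  have h₁' := forced_comp_add_right h₁ a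
  have h₂' := forced_comp_add_right h₂ a
  rw [preimage_add_const_Icc_self] at h₁' h₂'
  have h0' : (fun t => θ₁ (t + a)) 0 = (fun t => θ₂ (t + a)) 0 := by
    simp only [zero_add]; exact h0
  have heq := IsClassicalScalarTransportForcedOn.eq_on_Icc hκ hT h₁' h₂' h0'
  intro t ht
  have := heq (t - a) ⟨by linarith [ht.1], by linarith [ht.2]⟩
  simpa using this

/-- Existence and uniqueness of classical RELEASES (homogeneous equation) on any window
`[a, b]`, `a < b`, from a smooth datum at time `a`. [cite: Krylov1996, Thm. 9.2.3] -/
theorem exists_isClassicalScalarTransportOn_Icc (hκ : 0 < κ) (hab : a < b)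
    (hu : IsSmoothSpaceTimeOn (Icc a b) u) (hdiv : ∀ t ∈ Icc a b, IsDivFree (u t))
    (hθ₀ : IsSmooth θ₀) :
    ∃ φ : ℝ → UnitAddTorus d → ℝ, IsClassicalScalarTransportOn (Icc a b) κ u φ ∧ φ a = θ₀ := by
  have h0 : IsSmoothSpaceTimeOn (Icc a b) (0 : ℝ → UnitAddTorus d → ℝ) :=
    isSmoothSpaceTimeOn_const (isSmooth_const (0 : ℝ)) _
  obtain ⟨φ, hφ, hφ0⟩ := exists_isClassicalScalarTransportForcedOn_Icc hκ hab hu hdiv h0 hθ₀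
  exact ⟨φ, (isClassicalScalarTransportForcedOn_zero_iff h0).1 hφ, hφ0⟩

end Window

section Global

variable {κ a : ℝ} {u : ℝ → UnitAddTorus d → EuclideanSpace ℝ d}
  {src : ℝ → UnitAddTorus d → ℝ} {θ₀ : UnitAddTorus d → ℝ}

/-- **Global classical forced solutions on `[a, ∞)`.** For `κ > 0`, a smooth divergence-free
drift and a smooth source on `[a, ∞)` and a smooth datum at time `a`, the forced
advection–diffusion equation has a classical solution on the whole half-line `Ici a` (jointly
smooth up to `t = a`, one-sided `timeDerivWithin (Ici a)`): glue the unique solutions on the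
windows `[a, a + n + 1]` (`exists_isClassicalScalarTransportForcedOn_Icc`, `forced_eq_on_Icc`);
smoothness and the one-sided time derivative are local. This is the existence half of
`stub_coldStartVariance`'s conclusion (the GLOBAL cold start). [cite: Krylov1996, Thm. 9.2.3] -/
theorem exists_isClassicalScalarTransportForcedOn_Ici (hκ : 0 < κ)
    (hu : IsSmoothSpaceTimeOn (Ici a) u) (hdiv : ∀ t ∈ Ici a, IsDivFree (u t))
    (hs : IsSmoothSpaceTimeOn (Ici a) src) (hθ₀ : IsSmooth θ₀) :
    ∃ θ : ℝ → UnitAddTorus d → ℝ,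
      IsClassicalScalarTransportForcedOn (Ici a) κ u src θ ∧ θ a = θ₀ := by
  -- the windows `[a, a + n + 1]`
  have hwin : ∀ n : ℕ, a < a + (n : ℝ) + 1 := fun n => by
    have : (0 : ℝ) ≤ n := Nat.cast_nonneg n
    linarith
  have hsub : ∀ n : ℕ, Icc a (a + (n : ℝ) + 1) ⊆ Ici a := fun n => Icc_subset_Ici_self
  have hex : ∀ n : ℕ, ∃ θ : ℝ → UnitAddTorus d → ℝ,
      IsClassicalScalarTransportForcedOn (Icc a (a + (n : ℝ) + 1)) κ u src θ ∧ θ a = θ₀ := fun n =>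
    exists_isClassicalScalarTransportForcedOn_Icc hκ (hwin n) (hu.mono (hsub n))
      (fun t ht => hdiv t (hsub n ht)) (hs.mono (hsub n)) hθ₀
  choose sol hsol hsol0 using hex
  -- compatibility of the window solutions
  have hcompat : ∀ m n : ℕ, m ≤ n → ∀ t ∈ Icc a (a + (m : ℝ) + 1), sol m t = sol n t := by
    intro m n hmn t ht
    have hmn' : (m : ℝ) ≤ n := Nat.cast_le.2 hmn
    have hIcc : Icc a (a + (m : ℝ) + 1) ⊆ Icc a (a + (n : ℝ) + 1) :=
      Icc_subset_Icc le_rfl (by linarith)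
    have hn' : IsClassicalScalarTransportForcedOn (Icc a (a + (m : ℝ) + 1)) κ u src (sol n) :=
      forced_restrict_Icc (hsol n) (hwin m) hIcc
    exact forced_eq_on_Icc hκ (hwin m) (hsol m) hn' ((hsol0 m).trans (hsol0 n).symm) t ht
  -- the glued field, indexed by `⌈t - a⌉₊`
  set idx : ℝ → ℕ := fun t => ⌈t - a⌉₊ with hidx
  set θ : ℝ → UnitAddTorus d → ℝ := fun t => sol (idx t) t with hθdef
  have hmemwin : ∀ t : ℝ, a ≤ t → t < a + (idx t : ℝ) + 1 := by
    intro t ht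
    have h1 : t - a ≤ (⌈t - a⌉₊ : ℝ) := Nat.le_ceil (t - a)
    simp only [hidx]
    linarith
  -- `θ` agrees with `sol n` on the whole window `n`
  have hagree : ∀ n : ℕ, ∀ t ∈ Icc a (a + (n : ℝ) + 1), θ t = sol n t := by
    intro n t ht
    simp only [hθdef]
    rcases le_total (idx t) n with h | h
    · exact hcompat (idx t) n h t ⟨ht.1, (hmemwin t ht.1).le⟩
    · exact (hcompat n (idx t) h t ht).symm
  refine ⟨θ, ?_, ?_⟩
  swap
  · -- the datum
    have := hagree 0 a ⟨le_rfl, (hwin 0).le⟩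
    rw [this]
    exact hsol0 0
  refine ⟨hu, hs, ?_, ?_, hdiv⟩
  · -- joint smoothness on `Ici a × T^d`: local, from the window solutions
    unfold IsSmoothSpaceTimeOn
    refine contDiffOn_of_locally_contDiffOn fun z hz => ?_
    obtain ⟨hz1, -⟩ := hz
    set n : ℕ := idx z.1 with hn
    refine ⟨Iio (a + (n : ℝ) + 1) ×ˢ univ, isOpen_Iio.prod isOpen_univ,
      mk_mem_prod (hmemwin z.1 hz1) (mem_univ _), ?_⟩
    have hsub' : (Ici a ×ˢ (univ : Set (EuclideanSpace ℝ d))) ∩ Iio (a + (n : ℝ) + 1) ×ˢ univ ⊆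
        Icc a (a + (n : ℝ) + 1) ×ˢ univ := by
      rintro w ⟨⟨hw1, -⟩, hw2, -⟩
      exact mk_mem_prod ⟨hw1, (le_of_lt hw2)⟩ (mem_univ _)
    have hsm : ContDiffOn ℝ ∞ (stLift (sol n)) (Icc a (a + (n : ℝ) + 1) ×ˢ univ) :=
      (hsol n).smooth_scalar
    refine (hsm.mono hsub').congr fun w hw => ?_
    have hw' := hsub' hw
    simp only [stLift]
    rw [hagree n w.1 hw'.1]
  · -- the equation, with the one-sided derivative within `Ici a`
    intro t ht x
    set n : ℕ := idx t with hn
    have htn : t ∈ Icc a (a + (n : ℝ) + 1) := ⟨ht, (hmemwin t ht).le⟩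
    have hlt : t < a + (n : ℝ) + 1 := hmemwin t ht
    -- time derivative: `θ = sol n` near `t` within `Ici a`, and `Icc = Ici ∩ Iic` near `t`
    have hev : (fun τ => θ τ x) =ᶠ[𝓝[Ici a] t] fun τ => sol n τ x := by
      have hmem : Iio (a + (n : ℝ) + 1) ∈ 𝓝[Ici a] t :=
        mem_nhdsWithin_of_mem_nhds (Iio_mem_nhds hlt)
      filter_upwards [hmem, self_mem_nhdsWithin] with τ hτ hτ'
      exact congrFun (hagree n τ ⟨hτ', le_of_lt hτ⟩) x
    have hd1 : timeDerivWithin (Ici a) θ t x = timeDerivWithin (Ici a) (sol n) t x := by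
      unfold timeDerivWithin
      exact hev.derivWithin_eq (congrFun (hagree n t htn) x)
    have hd2 : timeDerivWithin (Icc a (a + (n : ℝ) + 1)) (sol n) t x = timeDerivWithin (Ici a) (sol n) t x := by
      unfold timeDerivWithin
      rw [← Ici_inter_Iic]
      exact derivWithin_inter (Iic_mem_nhds hlt)
    have heq := (hsol n).transport t htn x
    rw [hd2] at heq
    rw [hd1, hagree n t htn]
    exact heq

end Global

end Summit.AnomalousDissipation.AnomalousDissipation.Theorems.ScalarAnomalySteadySourceFormal.Negative

end
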